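import Summits.QuantumFields.YangMills.Theorems.BalabanUVNodesN15KingModelBlockCovarianceFourier
import Summits.QuantumFields.YangMills.Theorems.BalabanUVNodesN15KingModelFreeRGGaussNorm
import Literature.MathematicalPhysics.QuantumFieldTheory.King1986.CovarianceSplitting

/-!
# BalabanUVNodes ∕ N15 — THE KING-MODEL RUNG (PART Ϝ-a): THE FINE-LATTICE GAUSSIAN GENERATING FUNCTIONAL OF THE FREE FIELD —
# `Z_η(Ω, h) = ∫ e^{⟨h,ψ⟩_η} dμ(ψ)`; AT BLOCK-CONSTANT SOURCES `h = J∘blk` IT IS `exp(½N^d⟨J, QB⁻¹QᵀJ⟩) = exp(½|Ω|⁻¹Σ_q S_N(q)|J̃(q)|²)` EXACTLY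
# (Track A, DAG node N15 = NE2; FAN-OUT v1.1 §N15 s3 «KING-MODEL RUNG … NE2's analogue DECIDED in the model»; toward Theorem 2.1 BY NAME, part Ϝ-b)

HONEST FRAMING.  Count-neutral (cell `pub-ymgap`, seat `pub-ymgap-dag-n15-e` g33; `--supports stmt-QuantumFields-27366 --as helper` = K3⁸
`SpineGivenEndpointR13SepCoPHV`).  TEMPLATE LITERATURE: C. King, *The U(1) Higgs model. I. The continuum limit*, Commun. Math. Phys. **102** (1986) 649–677
[King1986] — KING's OWN `A = 0`, `g = 0` MODEL (the FREE massive lattice scalar field; no gauge field, no interaction) on the fine torus `Ω_η = Tor (fine N M)`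
(`η = N⁻¹`, unit torus `Ω = Tor M = Π_μ ℤ∕M_μ`).  NOT the U(1) Higgs model's generating functional `Z^ε(T_ε, g, h)` of §2.1; NOT Bałaban's objects; NOT a node
discharge (N15 is booked through n15-a's knit, untouched here); nothing continuum-Yang–Mills ∕ ℝ⁴ ∕ OS ∕ mass-gap ∕ Clay.  0 `sorry`; standard axioms; THREE definitions
(`fineFreePrec`, `blockSrc`, `kingFineZ` — the objects themselves).

THE MATHEMATICS.  King's free action on the `η`-lattice is `½η^d Σ_x ψ(x)((−Δ^η + m²)ψ)(x)` ((2.2) at `A = 0`, `g = 0`; the quadratic part of (2.13) without the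
averaging term), `−Δ^η = η⁻²·(−Δ_lattice)`, so the field is Gaussian with PRECISION `P_η = η^d·B`, `B = N²(−Δ) + m² = lapF (fine N M) N² m²` ((4.4)), i.e. covariance
`P_η⁻¹ = N^d·B⁻¹`.  A source `h` couples through the Riemann pairing `⟨h, ψ⟩_η = η^d Σ_x h(x)ψ(x)`, and the GENERATING FUNCTIONAL is the normalised Gaussian
integral `Z_η(Ω, h) = ∫ e^{⟨h,ψ⟩_η} e^{−½⟨ψ,P_ηψ⟩}dψ ∕ 𝒩(P_η) = exp(½⟨η^d h, P_η⁻¹ η^d h⟩) = exp(½ η^d ⟨h, B⁻¹h⟩)` (part Τ-a's `integral_exp_dot_gaussDensity`).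
For a source CONSTANT ON UNIT BLOCKS, `h = J∘blockOf` (`J : Ω → ℝ`), the pairing IS the block mean: `⟨J∘blk, ψ⟩_η = Σ_b J(b)·η^dΣ_{x∈B(b)}ψ(x) = ⟨J, Qψ⟩`
(`η^d(J∘blk) = QᵀJ`, tree `transpose_Qmat_mulVec`), so `Z_η(Ω, J∘blk) = exp(½⟨QᵀJ, N^dB⁻¹QᵀJ⟩) = exp(½N^d⟨J, QB⁻¹QᵀJ⟩)` — the block-averaged free propagator of
parts Ϛ∕Ϡ-d — `= exp(½|Ω|⁻¹Σ_q S_N(q)|J̃(q)|²)` by 254's `blockAvg_form`.  Since `0 ≤ S_N(q) ≤ m⁻²` (`Σ_{fib}|u|² = 1`, `σ ≥ m²`) and `|Ω|⁻¹Σ_q|J̃(q)|² =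
⟨J,J⟩` (Plancherel): `0 ≤ ln Z_η(Ω, J∘blk) ≤ ⟨J,J⟩∕(2m²) ≤ H²|Ω|∕(2m²)` for `|J| ≤ H` — UNIFORM in `η` and EXTENSIVE, the shape of (2.23).  For an ARBITRARY source
the same coercivity gives `0 ≤ ln Z_η(Ω, h) ≤ ‖h‖²_η∕(2m²)`, `‖h‖²_η = η^dΣ_x h(x)²`.

WHAT THIS FILE PROVES (kernel).  §0 letters: `dot_inv_mulVec_le_of_coercive` (`⟨y, S⁻¹y⟩ ≤ γ⁻¹⟨y,y⟩` for `S ≥ γ > 0`), `dot_inv_mulVec_nonneg_of_coercive`, ★ `Sfib_le_inv_mass`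
(`S(q) ≤ m⁻²`).  §1 `fineFreePrec` (`P_η = N^{−d}·B`), `fineFreePrec_transpose`, `coercive_fineFreePrec` (`≥ N^{−d}m²`), `fineFreePrec_gap_pos`, `isUnit_det_lapF`, `fineFreePrec_inv`
(`P_η⁻¹ = N^d·B⁻¹`).  §2 `blockSrc` (`J∘blk`), `blockSrc_apply`, ★ `smul_blockSrc_eq` (`η^d(J∘blk) = QᵀJ`), `blockSrc_pair_eq` (`⟨J∘blk, ψ⟩_η = ⟨J, Qψ⟩`), `abs_blockSrc_le`,
`blockSrc_eq_smul`, `Qmat_mulVec_blockSrc` (`Q(J∘blk) = J`), `blockSrc_sq_sum` (`‖J∘blk‖²_η = ⟨J,J⟩`).  §3 `kingFineZ` (the generating functional), ★★ `kingFineZ_eq_exp` (every source),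
`kingFineZ_pos`, ★ `log_kingFineZ_nonneg`, ★★ `log_kingFineZ_le` (`≤ ‖h‖²_η∕(2m²)`).  §4 ★★ **`kingFineZ_blockSrc_eq`** (`= exp(½N^d⟨J,QB⁻¹QᵀJ⟩)`), ★★★
**`kingFineZ_blockSrc_eq_fourier`** (`= exp(½|Ω|⁻¹Σ_q S_N(q)|J̃(q)|²)`), `log_kingFineZ_blockSrc_eq(_fourier)`, `fourierSum_Sfib_le` (`≤ m⁻²⟨J,J⟩`), `fourierSum_Sfib_nonneg`,
`log_kingFineZ_blockSrc_nonneg`, ★★ `log_kingFineZ_blockSrc_le` (`≤ ⟨J,J⟩∕(2m²)`), `dotProduct_self_le_vol`, ★★ **`log_kingFineZ_blockSrc_le_vol`** (`≤ H²∕(2m²)·|Ω|`),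
`abs_log_kingFineZ_blockSrc_le_vol`.

HONEST SCOPE.  Exact Gaussian identities and the uniform mass bound in King's free `A = 0` model on finite tori; every `N ≥ 1`, every unit torus `M`, `m² > 0`.
The curved case (Bałaban's background-dependent covariances) and the interacting U(1) Higgs functional are not addressed.  N15 untouched; counts unmoved.
Locators: [King1986] (2.1)–(2.2) p.651, (2.4)–(2.6) p.652, (2.13) p.653, Thm 2.1 (2.22)–(2.23) p.654, (4.1)–(4.5) p.670, (4.35) p.674.
-/

noncomputable section

open scoped BigOperators
open Finset Matrix MeasureTheory

namespace Summit.QuantumFields.YangMills.BalabanUVNodes.N15KingModelRung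

open Literature.MathematicalPhysics.QuantumFieldTheory.Balaban1983to89.B5Prop11Plancherel (Tor fine chi)
open Literature.MathematicalPhysics.QuantumFieldTheory.Balaban1983to89.QGQInverse (Coercive isUnit_of_coercive)
open Literature.MathematicalPhysics.QuantumFieldTheory.King1986.Torus
open Summit.QuantumFields.YangMills.BalabanUVNodes.N15KingModelRung.FreeField (gaussNorm gaussNorm_pos integral_exp_dot_gaussDensity coercive_smul)

variable {d : ℕ}

/-! ## §0 Letters: the inverse of a coercive matrix as a form; `S(q) ≤ m⁻²` -/

section Letters

variable {ι : Type*} [Fintype ι] [DecidableEq ι]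

/-- For a coercive real matrix `S ≥ γ > 0`: `⟨y, S⁻¹y⟩ ≤ γ⁻¹⟨y, y⟩`. [folklore] -/
theorem dot_inv_mulVec_le_of_coercive {S : Matrix ι ι ℝ} {γ : ℝ} (hγ : 0 < γ) (h : Coercive S γ) (y : ι → ℝ) :
    y ⬝ᵥ (S⁻¹ *ᵥ y) ≤ γ⁻¹ * (y ⬝ᵥ y) := by
  set x := S⁻¹ *ᵥ y with hx
  have hU : IsUnit S.det := (Matrix.isUnit_iff_isUnit_det S).mp (isUnit_of_coercive hγ h)
  have hSx : S *ᵥ x = y := by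
    rw [hx, Matrix.mulVec_mulVec, Matrix.mul_nonsing_inv S hU, Matrix.one_mulVec]
  have hc : γ * (x ⬝ᵥ x) ≤ x ⬝ᵥ y := by simpa [hSx] using h x
  have hxx : 0 ≤ x ⬝ᵥ x := Literature.LinearAlgebra.Matrix.dotProduct_self_nonneg_real x
  have hyy : 0 ≤ y ⬝ᵥ y := Literature.LinearAlgebra.Matrix.dotProduct_self_nonneg_real y
  have hcs : (x ⬝ᵥ y) ^ 2 ≤ (x ⬝ᵥ x) * (y ⬝ᵥ y) :=
    Literature.MathematicalPhysics.QuantumFieldTheory.Balaban1983to89.B9Thm311.dot_sq_le x y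
  have hxy : y ⬝ᵥ x = x ⬝ᵥ y := dotProduct_comm y x
  rw [hxy]
  have hxy0 : 0 ≤ x ⬝ᵥ y := le_trans (mul_nonneg hγ.le hxx) hc
  -- `γ (x⬝y)² ≤ γ (x⬝x)(y⬝y) ≤ (x⬝y)(y⬝y)`
  have h1 : γ * (x ⬝ᵥ y) ^ 2 ≤ (x ⬝ᵥ y) * (y ⬝ᵥ y) := by
    calc γ * (x ⬝ᵥ y) ^ 2 ≤ γ * ((x ⬝ᵥ x) * (y ⬝ᵥ y)) := mul_le_mul_of_nonneg_left hcs hγ.le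
      _ = (γ * (x ⬝ᵥ x)) * (y ⬝ᵥ y) := by ring
      _ ≤ (x ⬝ᵥ y) * (y ⬝ᵥ y) := mul_le_mul_of_nonneg_right hc hyy
  rcases hxy0.eq_or_lt with h0 | hpos
  · rw [← h0]
    exact mul_nonneg (inv_nonneg.mpr hγ.le) hyy
  · have h2 : γ * (x ⬝ᵥ y) ≤ y ⬝ᵥ y := by
      have h3 : (γ * (x ⬝ᵥ y)) * (x ⬝ᵥ y) ≤ (y ⬝ᵥ y) * (x ⬝ᵥ y) := by
        calc (γ * (x ⬝ᵥ y)) * (x ⬝ᵥ y) = γ * (x ⬝ᵥ y) ^ 2 := by ring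
          _ ≤ (x ⬝ᵥ y) * (y ⬝ᵥ y) := h1
          _ = (y ⬝ᵥ y) * (x ⬝ᵥ y) := by ring
      exact le_of_mul_le_mul_right h3 hpos
    calc x ⬝ᵥ y = γ⁻¹ * (γ * (x ⬝ᵥ y)) := by field_simp
      _ ≤ γ⁻¹ * (y ⬝ᵥ y) := by gcongr

/-- For a coercive real matrix `S ≥ γ > 0`: `0 ≤ ⟨y, S⁻¹y⟩`. [folklore] -/
theorem dot_inv_mulVec_nonneg_of_coercive {S : Matrix ι ι ℝ} {γ : ℝ} (hγ : 0 < γ) (h : Coercive S γ) (y : ι → ℝ) :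
    0 ≤ y ⬝ᵥ (S⁻¹ *ᵥ y) := by
  set x := S⁻¹ *ᵥ y with hx
  have hU : IsUnit S.det := (Matrix.isUnit_iff_isUnit_det S).mp (isUnit_of_coercive hγ h)
  have hSx : S *ᵥ x = y := by
    rw [hx, Matrix.mulVec_mulVec, Matrix.mul_nonsing_inv S hU, Matrix.one_mulVec]
  have hc : γ * (x ⬝ᵥ x) ≤ x ⬝ᵥ y := by simpa [hSx] using h x
  have hxx : 0 ≤ x ⬝ᵥ x := Literature.LinearAlgebra.Matrix.dotProduct_self_nonneg_real x
  rw [dotProduct_comm]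
  exact le_trans (mul_nonneg hγ.le hxx) hc

end Letters

section Mass

variable (N : ℕ) [NeZero N] (M : Fin d → ℕ) [hM : ∀ μ, NeZero (M μ)]

/-- ★ `S(q) ≤ m⁻²` for `c ≥ 0`, `m² > 0`: every alias term has `σ(p) ≥ m²` and the fibre weights sum to one (`Σ_{p ∈ fib q}|u(p)|² = 1`).
[cite: King1986, (4.5) p.670, (4.14) p.671] -/
theorem Sfib_le_inv_mass {c m2 : ℝ} (hc : 0 ≤ c) (hm : 0 < m2) (q : Tor M) : Sfib N M c m2 q ≤ m2⁻¹ := by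
  unfold Sfib
  calc ∑ p ∈ fib N M q, ‖u N M p‖ ^ 2 / lapSym (fine N M) c m2 p
      ≤ ∑ p ∈ fib N M q, ‖u N M p‖ ^ 2 / m2 := by
        refine Finset.sum_le_sum fun p _ => ?_
        exact div_le_div_of_nonneg_left (sq_nonneg _) hm (lapSym_ge (fine N M) c m2 hc p)
    _ = m2⁻¹ := by rw [← Finset.sum_div, sum_fib_norm_sq_u, one_div]

end Mass

/-! ## §1 The precision of King's free fine-lattice field -/

section Precision

variable (N : ℕ) [NeZero N] (M : Fin d → ℕ) [hM : ∀ μ, NeZero (M μ)]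

/-- **The precision matrix of King's free field on the `η`-lattice** `Ω_η = Tor (fine N M)`, `η = N⁻¹`: `P_η = η^d·(−Δ^η + m²) = N^{−d}·B`,
`B = N²(−Δ) + m²` — the quadratic form of the free action `½η^dΣ_x ψ(−Δ^η + m²)ψ` ((2.2) at `A = 0`; (2.13) without the averaging term).
[cite: King1986, (2.2) p.651, (2.13) p.653, (4.4) p.670] -/
def fineFreePrec (m2 : ℝ) : Matrix (Tor (fine N M)) (Tor (fine N M)) ℝ :=
  (((N : ℝ) ^ d)⁻¹) • lapF (fine N M) ((N : ℝ) ^ 2) m2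

omit [NeZero N] hM in
/-- `P_η` is symmetric. [cite: King1986, (4.4) p.670] -/
theorem fineFreePrec_transpose (m2 : ℝ) : (fineFreePrec N M m2)ᵀ = fineFreePrec N M m2 := by
  ext z z'
  simp only [fineFreePrec, Matrix.transpose_apply, Matrix.smul_apply, lapF_comm]

/-- `P_η ≥ N^{−d}m²` as a quadratic form. [cite: King1986, (4.4) p.670, (4.8) p.671] -/
theorem coercive_fineFreePrec (m2 : ℝ) : Coercive (fineFreePrec N M m2) (((N : ℝ) ^ d)⁻¹ * m2) :=
  coercive_smul (lapF_coercive (fine N M) ((N : ℝ) ^ 2) m2 (by positivity)) (by positivity)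

/-- `N^{−d}m² > 0`. [folklore] -/
theorem fineFreePrec_gap_pos {m2 : ℝ} (hm : 0 < m2) : 0 < ((N : ℝ) ^ d)⁻¹ * m2 := by
  have hN : (0 : ℝ) < N := by exact_mod_cast Nat.pos_of_ne_zero (NeZero.ne N)
  positivity

/-- `B = N²(−Δ) + m²` has a unit determinant (`B ≥ m² > 0`). [folklore] -/
theorem isUnit_det_lapF {m2 : ℝ} (hm : 0 < m2) : IsUnit (lapF (fine N M) ((N : ℝ) ^ 2) m2).det :=
  (Matrix.isUnit_iff_isUnit_det _).mp (isUnit_of_coercive hm (lapF_coercive (fine N M) ((N : ℝ) ^ 2) m2 (by positivity)))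

/-- **The covariance**: `P_η⁻¹ = N^d·B⁻¹`. [cite: King1986, (2.13) p.653, (4.5) p.670] -/
theorem fineFreePrec_inv {m2 : ℝ} (hm : 0 < m2) :
    (fineFreePrec N M m2)⁻¹ = ((N : ℝ) ^ d) • (lapF (fine N M) ((N : ℝ) ^ 2) m2)⁻¹ := by
  have hN : (N : ℝ) ^ d ≠ 0 := pow_ne_zero _ (by exact_mod_cast NeZero.ne N)
  refine Matrix.inv_eq_right_inv ?_
  rw [fineFreePrec, Matrix.smul_mul, Matrix.mul_smul, smul_smul, inv_mul_cancel₀ hN, one_smul,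
    Matrix.mul_nonsing_inv _ (isUnit_det_lapF N M hm)]

end Precision

/-! ## §2 Block-constant sources and the Riemann pairing -/

section Sources

variable (N : ℕ) [NeZero N] (M : Fin d → ℕ) [hM : ∀ μ, NeZero (M μ)]

/-- A fine-lattice source CONSTANT ON UNIT BLOCKS: `(J∘blk)(x) = J(b(x))`. [cite: King1986, (2.4) p.652, (4.1) p.670] -/
def blockSrc (J : Tor M → ℝ) : Tor (fine N M) → ℝ := fun x => J (blockOf N M x)

/-- `(J∘blk)(x) = J(b(x))`. [folklore] -/
@[simp] theorem blockSrc_apply (J : Tor M → ℝ) (x : Tor (fine N M)) : blockSrc N M J x = J (blockOf N M x) := rfl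

/-- ★ The Riemann-weighted block-constant source IS the transposed block mean: `η^d·(J∘blk) = QᵀJ`. [cite: King1986, (2.4) p.652, (4.1)–(4.3) p.670] -/
theorem smul_blockSrc_eq (J : Tor M → ℝ) : (((N : ℝ) ^ d)⁻¹) • blockSrc N M J = (Qmat N M)ᵀ *ᵥ J := by
  ext x
  rw [Pi.smul_apply, smul_eq_mul, transpose_Qmat_mulVec, blockSrc_apply]

/-- The Riemann pairing of a block-constant source with a fine field is the pairing of `J` with the block mean:
`⟨J∘blk, ψ⟩_η = η^dΣ_x J(b(x))ψ(x) = ⟨J, Qψ⟩`. [cite: King1986, (2.4) p.652, (4.1) p.670] -/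
theorem blockSrc_pair_eq (J : Tor M → ℝ) (ψ : Tor (fine N M) → ℝ) :
    ((((N : ℝ) ^ d)⁻¹) • blockSrc N M J) ⬝ᵥ ψ = J ⬝ᵥ (Qmat N M *ᵥ ψ) := by
  rw [smul_blockSrc_eq, Matrix.dotProduct_mulVec, Matrix.mulVec_transpose]

/-- A bounded block source gives a bounded fine source. [folklore] -/
theorem abs_blockSrc_le {J : Tor M → ℝ} {H : ℝ} (hJ : ∀ b, |J b| ≤ H) (x : Tor (fine N M)) : |blockSrc N M J x| ≤ H := hJ _

/-- `J∘blk = N^d·QᵀJ`. [folklore] -/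
theorem blockSrc_eq_smul (J : Tor M → ℝ) : blockSrc N M J = ((N : ℝ) ^ d) • ((Qmat N M)ᵀ *ᵥ J) := by
  have hN : (N : ℝ) ^ d ≠ 0 := pow_ne_zero _ (by exact_mod_cast NeZero.ne N)
  rw [← smul_blockSrc_eq, smul_smul, mul_inv_cancel₀ hN, one_smul]

/-- The block mean of a block-constant function is the function: `Q(J∘blk) = J`. [cite: King1986, (2.4) p.652] -/
theorem Qmat_mulVec_blockSrc (J : Tor M → ℝ) : Qmat N M *ᵥ blockSrc N M J = J := by
  have hN : (N : ℝ) ^ d ≠ 0 := pow_ne_zero _ (by exact_mod_cast NeZero.ne N)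
  rw [blockSrc_eq_smul, Matrix.mulVec_smul, Matrix.mulVec_mulVec, Qmat_mul_transpose_Qmat, Matrix.smul_mulVec,
    Matrix.one_mulVec, smul_smul, mul_inv_cancel₀ hN, one_smul]

/-- `‖J∘blk‖²_η = η^dΣ_x J(b(x))² = Σ_b J(b)² = ⟨J, J⟩` (each unit block has `N^d` fine sites). [cite: King1986, (4.1) p.670] -/
theorem blockSrc_sq_sum (J : Tor M → ℝ) :
    ((N : ℝ) ^ d)⁻¹ * (blockSrc N M J ⬝ᵥ blockSrc N M J) = J ⬝ᵥ J := by
  have h1 : ((N : ℝ) ^ d)⁻¹ * (blockSrc N M J ⬝ᵥ blockSrc N M J) = ((((N : ℝ) ^ d)⁻¹) • blockSrc N M J) ⬝ᵥ blockSrc N M J := by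
    rw [smul_dotProduct, smul_eq_mul]
  rw [h1, blockSrc_pair_eq, Qmat_mulVec_blockSrc]

end Sources

/-! ## §3 The generating functional `Z_η(Ω, h)` -/

section Functional

variable (N : ℕ) [NeZero N] (M : Fin d → ℕ) [hM : ∀ μ, NeZero (M μ)]

/-- **King's fine-lattice generating functional of the FREE field** (`g = 0`, `A = 0`) at a source `h : Ω_η → ℝ`:
`Z_η(Ω, h) = ∫ e^{⟨h,ψ⟩_η} e^{−½⟨ψ, P_ηψ⟩} dψ ∕ 𝒩(P_η)`, `⟨h,ψ⟩_η = η^dΣ_x h(x)ψ(x)` — the `Z^ε(T_ε, ·)` of (2.1)∕Theorem 2.1 for the free model.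
[cite: King1986, (2.1)–(2.2) p.651, (2.6) p.652, Thm 2.1 (2.22) p.654] -/
def kingFineZ (m2 : ℝ) (h : Tor (fine N M) → ℝ) : ℝ :=
  ∫ ψ : Tor (fine N M) → ℝ, Real.exp (((((N : ℝ) ^ d)⁻¹) • h) ⬝ᵥ ψ)
    * (Real.exp (-(1 / 2 : ℝ) * (ψ ⬝ᵥ (fineFreePrec N M m2 *ᵥ ψ))) / gaussNorm (fineFreePrec N M m2))

/-- ★★ **THE GAUSSIAN FORMULA**: `Z_η(Ω, h) = exp(½⟨η^d h, P_η⁻¹ η^d h⟩)`, every source. [cite: King1986, (2.6) p.652, Thm 2.1 (2.22) p.654] -/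
theorem kingFineZ_eq_exp {m2 : ℝ} (hm : 0 < m2) (h : Tor (fine N M) → ℝ) :
    kingFineZ N M m2 h
      = Real.exp ((1 / 2 : ℝ) * (((((N : ℝ) ^ d)⁻¹) • h) ⬝ᵥ ((fineFreePrec N M m2)⁻¹ *ᵥ ((((N : ℝ) ^ d)⁻¹) • h)))) :=
  integral_exp_dot_gaussDensity (fineFreePrec_gap_pos N hm) (coercive_fineFreePrec N M m2) (fineFreePrec_transpose N M m2) _

/-- `Z_η(Ω, h) > 0`. [folklore] -/
theorem kingFineZ_pos {m2 : ℝ} (hm : 0 < m2) (h : Tor (fine N M) → ℝ) : 0 < kingFineZ N M m2 h := by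
  rw [kingFineZ_eq_exp N M hm]
  exact Real.exp_pos _

/-- ★ `ln Z_η(Ω, h) ≥ 0` (the covariance is a positive form). [cite: King1986, Thm 2.1 (2.23) p.654] -/
theorem log_kingFineZ_nonneg {m2 : ℝ} (hm : 0 < m2) (h : Tor (fine N M) → ℝ) : 0 ≤ Real.log (kingFineZ N M m2 h) := by
  rw [kingFineZ_eq_exp N M hm, Real.log_exp]
  exact mul_nonneg (by norm_num) (dot_inv_mulVec_nonneg_of_coercive (fineFreePrec_gap_pos N hm) (coercive_fineFreePrec N M m2) _)

/-- ★★ **THE UNIFORM MASS BOUND, every source**: `ln Z_η(Ω, h) ≤ ‖h‖²_η∕(2m²)`, `‖h‖²_η = η^dΣ_x h(x)²` — uniform in `η` and the torus.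
[cite: King1986, Thm 2.1 (2.23) p.654, (4.8) p.671] -/
theorem log_kingFineZ_le {m2 : ℝ} (hm : 0 < m2) (h : Tor (fine N M) → ℝ) :
    Real.log (kingFineZ N M m2 h) ≤ ((N : ℝ) ^ d)⁻¹ * (h ⬝ᵥ h) / (2 * m2) := by
  rw [kingFineZ_eq_exp N M hm, Real.log_exp]
  have hN : (0 : ℝ) < (N : ℝ) ^ d := pow_pos (by exact_mod_cast Nat.pos_of_ne_zero (NeZero.ne N)) d
  have hb := dot_inv_mulVec_le_of_coercive (fineFreePrec_gap_pos N hm) (coercive_fineFreePrec N M m2) ((((N : ℝ) ^ d)⁻¹) • h)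
  have hsq : ((((N : ℝ) ^ d)⁻¹) • h) ⬝ᵥ ((((N : ℝ) ^ d)⁻¹) • h) = (((N : ℝ) ^ d)⁻¹) ^ 2 * (h ⬝ᵥ h) := by
    rw [smul_dotProduct, dotProduct_smul, smul_eq_mul, smul_eq_mul]; ring
  rw [hsq, mul_inv, inv_inv] at hb
  calc (1 / 2 : ℝ) * (((((N : ℝ) ^ d)⁻¹) • h) ⬝ᵥ ((fineFreePrec N M m2)⁻¹ *ᵥ ((((N : ℝ) ^ d)⁻¹) • h)))
      ≤ (1 / 2 : ℝ) * ((N : ℝ) ^ d * m2⁻¹ * ((((N : ℝ) ^ d)⁻¹) ^ 2 * (h ⬝ᵥ h))) := by gcongr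
    _ = ((N : ℝ) ^ d)⁻¹ * (h ⬝ᵥ h) / (2 * m2) := by field_simp

end Functional

/-! ## §4 Block-constant sources: the exact plane-wave form and the extensive bound -/

section BlockConstant

variable (N : ℕ) [NeZero N] (M : Fin d → ℕ) [hM : ∀ μ, NeZero (M μ)]

/-- ★★ **AT A BLOCK-CONSTANT SOURCE THE GENERATING FUNCTIONAL IS THE BLOCK-AVERAGED FREE PROPAGATOR**:
`Z_η(Ω, J∘blk) = exp(½N^d⟨J, QB⁻¹QᵀJ⟩)`. [cite: King1986, (2.4)–(2.6) p.652, (2.13)–(2.14) p.653, Thm 2.1 (2.22) p.654] -/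
theorem kingFineZ_blockSrc_eq {m2 : ℝ} (hm : 0 < m2) (J : Tor M → ℝ) :
    kingFineZ N M m2 (blockSrc N M J)
      = Real.exp ((1 / 2 : ℝ) * ((N : ℝ) ^ d
          * (J ⬝ᵥ ((Qmat N M * (lapF (fine N M) ((N : ℝ) ^ 2) m2)⁻¹ * (Qmat N M)ᵀ) *ᵥ J)))) := by
  rw [kingFineZ_eq_exp N M hm, smul_blockSrc_eq, fineFreePrec_inv N M hm]
  congr 2
  rw [Matrix.smul_mulVec, dotProduct_smul, smul_eq_mul, ← Matrix.mulVec_mulVec, ← Matrix.mulVec_mulVec,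
    Matrix.dotProduct_mulVec J, ← Matrix.mulVec_transpose]

/-- ★★★ **THE EXACT PLANE-WAVE FORM**: `Z_η(Ω, J∘blk) = exp(½|Ω|⁻¹Σ_q S_N(q)|J̃(q)|²)`, `S_N` King's alias sum of (4.5), `J̃` the transform of (4.35).
[cite: King1986, (4.5) p.670, (4.35)–(4.36) p.674, Thm 2.1 (2.22) p.654] -/
theorem kingFineZ_blockSrc_eq_fourier {m2 : ℝ} (hm : 0 < m2) (J : Tor M → ℝ) :
    kingFineZ N M m2 (blockSrc N M J)
      = Real.exp ((1 / 2 : ℝ) * ((Fintype.card (Tor M) : ℝ)⁻¹ * ∑ q : Tor M, Sfib N M ((N : ℝ) ^ 2) m2 q * ‖ft M J q‖ ^ 2)) := by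
  rw [kingFineZ_blockSrc_eq N M hm, blockAvg_form N M (by positivity) hm J]

/-- `ln Z_η(Ω, J∘blk) = ½N^d⟨J, QB⁻¹QᵀJ⟩`. [cite: King1986, (2.14) p.653, Thm 2.1 (2.22) p.654] -/
theorem log_kingFineZ_blockSrc_eq {m2 : ℝ} (hm : 0 < m2) (J : Tor M → ℝ) :
    Real.log (kingFineZ N M m2 (blockSrc N M J))
      = (1 / 2 : ℝ) * ((N : ℝ) ^ d * (J ⬝ᵥ ((Qmat N M * (lapF (fine N M) ((N : ℝ) ^ 2) m2)⁻¹ * (Qmat N M)ᵀ) *ᵥ J))) := by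
  rw [kingFineZ_blockSrc_eq N M hm, Real.log_exp]

/-- `ln Z_η(Ω, J∘blk) = ½|Ω|⁻¹Σ_q S_N(q)|J̃(q)|²`. [cite: King1986, (4.5) p.670, (4.35) p.674] -/
theorem log_kingFineZ_blockSrc_eq_fourier {m2 : ℝ} (hm : 0 < m2) (J : Tor M → ℝ) :
    Real.log (kingFineZ N M m2 (blockSrc N M J))
      = (1 / 2 : ℝ) * ((Fintype.card (Tor M) : ℝ)⁻¹ * ∑ q : Tor M, Sfib N M ((N : ℝ) ^ 2) m2 q * ‖ft M J q‖ ^ 2) := by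
  rw [kingFineZ_blockSrc_eq_fourier N M hm, Real.log_exp]

/-- The plane-wave sum is dominated by the mass: `|Ω|⁻¹Σ_q S_N(q)|J̃(q)|² ≤ m⁻²⟨J, J⟩` (`S ≤ m⁻²` + Plancherel). [cite: King1986, (4.5) p.670, (4.35) p.674] -/
theorem fourierSum_Sfib_le {m2 : ℝ} (hm : 0 < m2) (J : Tor M → ℝ) :
    (Fintype.card (Tor M) : ℝ)⁻¹ * ∑ q : Tor M, Sfib N M ((N : ℝ) ^ 2) m2 q * ‖ft M J q‖ ^ 2 ≤ m2⁻¹ * (J ⬝ᵥ J) := by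
  have hcard : (0 : ℝ) < Fintype.card (Tor M) := by exact_mod_cast Fintype.card_pos
  calc (Fintype.card (Tor M) : ℝ)⁻¹ * ∑ q : Tor M, Sfib N M ((N : ℝ) ^ 2) m2 q * ‖ft M J q‖ ^ 2
      ≤ (Fintype.card (Tor M) : ℝ)⁻¹ * ∑ q : Tor M, m2⁻¹ * ‖ft M J q‖ ^ 2 := by
        gcongr with q _
        exact Sfib_le_inv_mass N M (by positivity) hm q
    _ = m2⁻¹ * (J ⬝ᵥ J) := by
        rw [← Finset.mul_sum, ← parseval_dot]
        field_simp

/-- The plane-wave sum is nonnegative. [folklore] -/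
theorem fourierSum_Sfib_nonneg {m2 : ℝ} (hm : 0 < m2) (J : Tor M → ℝ) :
    0 ≤ (Fintype.card (Tor M) : ℝ)⁻¹ * ∑ q : Tor M, Sfib N M ((N : ℝ) ^ 2) m2 q * ‖ft M J q‖ ^ 2 := by
  refine mul_nonneg (by positivity) (Finset.sum_nonneg fun q _ => mul_nonneg ?_ (sq_nonneg _))
  exact Sfib_nonneg (by positivity) hm q

/-- ★ `0 ≤ ln Z_η(Ω, J∘blk)`. [cite: King1986, Thm 2.1 (2.23) p.654] -/
theorem log_kingFineZ_blockSrc_nonneg {m2 : ℝ} (hm : 0 < m2) (J : Tor M → ℝ) : 0 ≤ Real.log (kingFineZ N M m2 (blockSrc N M J)) :=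
  log_kingFineZ_nonneg N M hm _

/-- ★★ `ln Z_η(Ω, J∘blk) ≤ ⟨J, J⟩∕(2m²)`, uniformly in `η` and the torus. [cite: King1986, Thm 2.1 (2.23) p.654, (4.8) p.671] -/
theorem log_kingFineZ_blockSrc_le {m2 : ℝ} (hm : 0 < m2) (J : Tor M → ℝ) :
    Real.log (kingFineZ N M m2 (blockSrc N M J)) ≤ (J ⬝ᵥ J) / (2 * m2) := by
  rw [log_kingFineZ_blockSrc_eq_fourier N M hm]
  have := fourierSum_Sfib_le N M hm J
  calc (1 / 2 : ℝ) * ((Fintype.card (Tor M) : ℝ)⁻¹ * ∑ q : Tor M, Sfib N M ((N : ℝ) ^ 2) m2 q * ‖ft M J q‖ ^ 2)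
      ≤ (1 / 2 : ℝ) * (m2⁻¹ * (J ⬝ᵥ J)) := by gcongr
    _ = (J ⬝ᵥ J) / (2 * m2) := by field_simp

/-- `⟨J, J⟩ ≤ H²·|Ω|` for `|J| ≤ H`. [folklore] -/
theorem dotProduct_self_le_vol {J : Tor M → ℝ} {H : ℝ} (hJ : ∀ b, |J b| ≤ H) : J ⬝ᵥ J ≤ H ^ 2 * Fintype.card (Tor M) := by
  calc J ⬝ᵥ J = ∑ b, J b ^ 2 := by simp [dotProduct, sq]
    _ ≤ ∑ _b : Tor M, H ^ 2 := Finset.sum_le_sum fun b _ => by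
        have := hJ b
        rw [← sq_abs]
        exact pow_le_pow_left₀ (abs_nonneg _) this 2
    _ = H ^ 2 * Fintype.card (Tor M) := by rw [Finset.sum_const, Finset.card_univ, nsmul_eq_mul, mul_comm]

/-- ★★ **THE EXTENSIVE BOUND (the shape of (2.23))**: for a block source with `|J| ≤ H`, `ln Z_η(Ω, J∘blk) ≤ H²∕(2m²)·|Ω|`, uniformly in `η`.
[cite: King1986, Thm 2.1 (2.23) p.654] -/
theorem log_kingFineZ_blockSrc_le_vol {m2 : ℝ} (hm : 0 < m2) {J : Tor M → ℝ} {H : ℝ} (hJ : ∀ b, |J b| ≤ H) :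
    Real.log (kingFineZ N M m2 (blockSrc N M J)) ≤ H ^ 2 / (2 * m2) * Fintype.card (Tor M) := by
  have h1 := log_kingFineZ_blockSrc_le N M hm J
  have h2 := dotProduct_self_le_vol M hJ
  calc Real.log (kingFineZ N M m2 (blockSrc N M J)) ≤ (J ⬝ᵥ J) / (2 * m2) := h1
    _ ≤ (H ^ 2 * Fintype.card (Tor M)) / (2 * m2) := by gcongr
    _ = H ^ 2 / (2 * m2) * Fintype.card (Tor M) := by ring

/-- `|ln Z_η(Ω, J∘blk)| ≤ H²∕(2m²)·|Ω|`. [cite: King1986, Thm 2.1 (2.23) p.654] -/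
theorem abs_log_kingFineZ_blockSrc_le_vol {m2 : ℝ} (hm : 0 < m2) {J : Tor M → ℝ} {H : ℝ} (hJ : ∀ b, |J b| ≤ H) :
    |Real.log (kingFineZ N M m2 (blockSrc N M J))| ≤ H ^ 2 / (2 * m2) * Fintype.card (Tor M) := by
  rw [abs_of_nonneg (log_kingFineZ_blockSrc_nonneg N M hm J)]
  exact log_kingFineZ_blockSrc_le_vol N M hm hJ

end BlockConstant

end Summit.QuantumFields.YangMills.BalabanUVNodes.N15KingModelRung

end
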